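import Summits.BirchSwinnertonDyer.BirchSwinnertonDyer.Theorems.GoldfeldAllTwistsTwoConverseTwinBirchLemmaKrizLi7EvenDiscr
import HarnessLib

set_option linter.dupNamespace false -- namespace `…BirchSwinnertonDyer.BirchSwinnertonDyer…` is the cell's (D-0017 nested layout)
set_option autoImplicit false

/-!
# LINE B49, file 4h — the `−8q` family (B49₈, twists `49a1^{(−2q)}`, `K = ℚ(√−2q)`): a certificate kit for `n = 2q`
# and the members `q = 13, 17, 41` (`q ≡ 1 (mod 4)`) and `q = 19, 31, 47` (`q ≡ 3 (mod 4)`)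

Cell `bsd-goldfeld`, seat `bsd-goldfeld-s1p-c301` (prover, gen 5). `--supports` the S1⁺ route items stmt-BirchSwinnertonDyer-20044 (K12₂″)
/ 19140 (twin″). File 4e (`…KrizLi7EvenDiscr`) proved T1′/T2′ for EVERY even discriminant `d_K = −4n` with `7` split; the cell's SECOND prime
family — seat c301 gen 4's sibling conjecture `X049BirchLemmaEvenDiscrEight` (`d_K = −8q`, twists `49a1^{(−2q)}`, `q` an odd prime with
`(q/7) = −1`; file `…TwinBirchLemmaEight`) — is the case `n = 2q`: `(−2q/7) = (−2/7)(q/7) = (−1)(−1) = +1`, so `ℚ(√−2q)` IS a `2`-ramified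
Heegner field of `X₀(49)`. The Kronecker value `[a odd]·(−2q/a)` in reciprocity form is `χ₈′(a)·(a/q)` for `q ≡ 1 (mod 4)` and
`χ₈(a)·(a/q)` for `q ≡ 3 (mod 4)` (bsd-cm `RouteU.jacobiSym_neg_two_mul_eq_χ₈'_mul / _χ₈_mul`, the `RouteUMemberE40 / E24` patterns). This
file proves the two generic `θ₁`-certificates **`norm_generalizedBernoulli_theta1_twoPrime_of_sum_one` / `_three`** (from ONE integer identity
`Σ_{j<56q} χ₈⁽′⁾(j)(j/q) j²⁹ = S` with `7 ∥ S`; witness of `θ ≠ 1`: `j = 56q − 1`), the wrappers **`not_isOfFinAddOrder_heegnerPoint_cm7_twoPrime_of_sum`**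
(every level-`49` Heegner point over `ℚ(√−2q)` has infinite order, granted KL19 Thm. 1.20) and **`analyticRank_eq_one_twoPrimeTwist_of_sum`**
(«D₂(q)»: `ord_{s=1} L(W, s) = 1` for every elliptic `W ≅ 49a1^{(−2q)}`, granted KL19, Modularity, CLTZ Thm. 1.2, Gross–Zagier, Heegner
rationality), and certifies six members (`S mod 49 = 14, 7, 14, 42, 28, 14` for `q = 13, 17, 41, 19, 31, 47`; `q = 59` is the first NON-unit and is
absent; `q = 3, 5` are bsd-cm's `E24 / E40`, consumed in file 4e). HONEST FRAMING: RANK axis at `p = 7` only; clause (ii) of B49₈ untouched;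
a twist-density-zero WITNESS family; both items OPEN; BSD is not proved by any of this. THEOREMS ONLY (no `def`, no instance, no named fact).

References: [KrizLi2019] Thm. 1.20 (pp. 7–8); [Washington1997] §5.1, Thm. 4.2; [Cox2013] §1.C Lemma 1.14, (1.15)–(1.18); [GrossZagier1986] I.(6.3).
-/

noncomputable section

open scoped Classical NumberTheorySymbols

open WeierstrassCurve NumberField DirichletCharacter
open Literature.NumberTheory Literature.NumberTheory.EllipticCurves
  Literature.NumberTheory.EllipticCurves.ModularForms
open Literature.NumberTheory.EllipticCurves.KrizLi2019 Literature.NumberTheory.LFunctions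
open Summit.BirchSwinnertonDyer.Rank1Residual
open Summit.BirchSwinnertonDyer.Rank1Residual.X12.O11.RouteU

namespace Summit.BirchSwinnertonDyer.BirchSwinnertonDyer.Theorems.GoldfeldGoodTwists

/-! ## §1 The generic `θ₁`-certificates for `n = 2q` -/

/-- `ord₇ (7·4·2q) = 1` for a prime `q ≠ 7`. [folklore] -/
theorem padicValNat_seven_mul_four_mul_two_mul_prime {q : ℕ} [Fact q.Prime] (hq7 : q ≠ 7) :
    padicValNat 7 (7 * (4 * (2 * q))) = 1 := by
  have hq : q.Prime := Fact.out
  have h : ¬ 7 ∣ 4 * (2 * q) := by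
    intro hd
    rcases (Nat.Prime.dvd_mul (by norm_num)).mp hd with h | h
    · revert h; decide
    · rcases (Nat.Prime.dvd_mul (by norm_num)).mp h with h | h
      · revert h; decide
      · exact hq7 ((Nat.prime_dvd_prime_iff_eq (by norm_num) hq).mp h).symm
  rw [padicValNat.mul (by norm_num) (Nat.pos_iff_ne_zero.mp (by have := hq.pos; omega)), padicValNat_self,
    padicValNat.eq_zero_of_not_dvd h]

/-- **The Kronecker value of `d = −8q` in reciprocity form, `q ≡ 1 (mod 4)`**: `[a odd]·(−2q/a) = χ₈'(a)·(a/q)`.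
[cite: Cox2013, §1.C Lemma 1.14 and (1.15)–(1.18)] -/
theorem kroneckerVal_negTwoPrime_eq_one {q : ℕ} (hq4 : q % 4 = 1) (a : ℕ) :
    (if Even a then (0 : ℤ) else J(-((2 * q : ℕ) : ℤ) | a)) = (if a % 2 = 0 then (0 : ℤ) else if a % 8 = 1 ∨ a % 8 = 3 then 1 else -1) * J((a : ℤ) | q) := by
  by_cases ha0 : Even a
  · rw [if_pos ha0, if_pos (Nat.even_iff.mp ha0), zero_mul]
  · have ha : Odd a := Nat.not_even_iff_odd.mp ha0
    rw [if_neg ha0, show (-((2 * q : ℕ) : ℤ)) = -(2 * (q : ℤ)) by push_cast; ring, jacobiSym_neg_two_mul_eq_χ₈'_mul hq4 ha, ZMod.χ₈'_nat_eq_if_mod_eight]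

set_option maxRecDepth 400000 in
/-- **THE GENERIC `θ₁`-CERTIFICATE for `n = 2q`, `q ≡ 1 (mod 4)` prime, `q ≠ 7`.** If `S = Σ_{j<56q} χ₈'(j)·(j/q)·j²⁹` (sum over
`Finset.range (7·(4·(2q)))`) has `7 ∣ S`, `7² ∤ S`, then `‖B_{1,θ}‖₇ = 1` for every Teichmüller `ω` and every `θ` mod `7·8q` with values
`[j odd]·(−2q/j)·ω(j)⁴` — the Bernoulli certificate of KL19 Thm. 1.20 for `(X₀(49), 7, ℚ(√−2q))` in the `hcert` shape of file 4e's T1′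
(`n = 2q`). Witness of `θ ≠ 1`: `j = 56q − 1` (`χ₈'(−1)·(−1/q) = −1`). [cite: KrizLi2019, Thm. 1.20 (p. 8) and §1.5 (1)]
[cite: Washington1997, §5.1 and Thm. 4.2] -/
theorem norm_generalizedBernoulli_theta1_twoPrime_of_sum_one {q : ℕ} [Fact q.Prime] (hq4 : q % 4 = 1) (hq7 : q ≠ 7)
    (S : ℤ)
    (hS : ∑ j ∈ Finset.range (7 * (4 * (2 * q))),
      ((if j % 2 = 0 then (0 : ℤ) else if j % 8 = 1 ∨ j % 8 = 3 then 1 else -1) * J((j : ℤ) | q)) * (j : ℤ) ^ (28 + 1) = S)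
    (h1 : (7 : ℤ) ∣ S) (h2 : ¬ (7 : ℤ) ^ 2 ∣ S)
    (ω : DirichletCharacter ℚ_[7] 7) (hω : IsTeichmullerCharacter ω) (θ : DirichletCharacter ℚ_[7] (7 * (4 * (2 * q))))
    (hθ : ∀ j : ZMod (7 * (4 * (2 * q))), θ j =
      ((if Even j.val then (0 : ℤ) else J(-((2 * q : ℕ) : ℤ) | j.val) : ℤ) : ℚ_[7]) * ω (j.val : ZMod 7) ^ 4) :
    ‖generalizedBernoulli 1 θ‖ = 1 := by
  have hq : q.Prime := Fact.out
  have hq0 : 0 < q := hq.pos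
  have hqodd : Odd q := Nat.odd_iff.mpr (by omega)
  have hθ' : ∀ j : ZMod (7 * (4 * (2 * q))), θ j =
      (((if j.val % 2 = 0 then (0 : ℤ) else if j.val % 8 = 1 ∨ j.val % 8 = 3 then 1 else -1) * J((j.val : ℤ) | q) : ℤ) : ℚ_[7]) * ω (j.val : ZMod 7) ^ 4 :=
    fun j => by rw [hθ j, kroneckerVal_negTwoPrime_eq_one hq4]
  have hθ1 : θ ≠ 1 := by
    intro h1
    obtain ⟨w, hw⟩ : ∃ w : ℕ, w + 1 = 7 * (4 * (2 * q)) := ⟨7 * (4 * (2 * q)) - 1, by omega⟩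
    have hv := hθ' ((w : ℕ) : ZMod (7 * (4 * (2 * q))))
    have hval : ((w : ℕ) : ZMod (7 * (4 * (2 * q)))).val = w := by
      rw [ZMod.val_natCast]; exact Nat.mod_eq_of_lt (by omega)
    have hw7 : ((w : ℕ) : ZMod 7) = ((6 : ℕ) : ZMod 7) := by
      rw [ZMod.natCast_eq_natCast_iff']; omega
    have hu : IsUnit ((w : ℕ) : ZMod (7 * (4 * (2 * q)))) := by
      rw [ZMod.isUnit_iff_coprime, ← hw]
      exact Nat.coprime_self_add_right.mpr (Nat.coprime_one_right _)
    rw [h1, hval, MulChar.one_apply hu, hw7, apply_neg_one_pow_four, mul_one] at hv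
    have hJ : J((w : ℤ) | q) = 1 := by
      have hwq : (w : ℤ) % (q : ℤ) = (-1 : ℤ) % (q : ℤ) := by
        have : (w : ℤ) = -1 + (q : ℤ) * 56 := by omega
        rw [this, Int.add_mul_emod_self_left]
      rw [jacobiSym.mod_left, hwq, ← jacobiSym.mod_left, jacobiSym.at_neg_one hqodd, ZMod.χ₄_nat_one_mod_four hq4]
    have hL : ((if w % 2 = 0 then (0 : ℤ) else if w % 8 = 1 ∨ w % 8 = 3 then 1 else -1) * J((w : ℤ) | q)) = -1 := by
      rw [if_neg (by omega), if_neg (by omega), hJ]; norm_num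
    rw [hL] at hv
    norm_num at hv
  refine norm_generalizedBernoulli_one_eq_one_of_cert_range θ hθ1 (padicValNat_seven_mul_four_mul_two_mul_prime hq7)
    (fun j => (if j % 2 = 0 then (0 : ℤ) else if j % 8 = 1 ∨ j % 8 = 3 then 1 else -1) * J((j : ℤ) | q)) 28 (fun j => ?_) S hS h1 h2
  have := norm_sub_le_of_values ω hω θ (fun j => (if j % 2 = 0 then (0 : ℤ) else if j % 8 = 1 ∨ j % 8 = 3 then 1 else -1) * J((j : ℤ) | q)) 4 (by norm_num) hθ' j
  simpa using this

/-- **The Kronecker value of `d = −8q` in reciprocity form, `q ≡ 3 (mod 4)`**: `[a odd]·(−2q/a) = χ₈(a)·(a/q)`.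
[cite: Cox2013, §1.C Lemma 1.14 and (1.15)–(1.18)] -/
theorem kroneckerVal_negTwoPrime_eq_three {q : ℕ} (hq4 : q % 4 = 3) (a : ℕ) :
    (if Even a then (0 : ℤ) else J(-((2 * q : ℕ) : ℤ) | a)) = (if a % 2 = 0 then (0 : ℤ) else if a % 8 = 1 ∨ a % 8 = 7 then 1 else -1) * J((a : ℤ) | q) := by
  by_cases ha0 : Even a
  · rw [if_pos ha0, if_pos (Nat.even_iff.mp ha0), zero_mul]
  · have ha : Odd a := Nat.not_even_iff_odd.mp ha0
    rw [if_neg ha0, show (-((2 * q : ℕ) : ℤ)) = -(2 * (q : ℤ)) by push_cast; ring, jacobiSym_neg_two_mul_eq_χ₈_mul hq4 ha, ZMod.χ₈_nat_eq_if_mod_eight]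

set_option maxRecDepth 400000 in
/-- **THE GENERIC `θ₁`-CERTIFICATE for `n = 2q`, `q ≡ 3 (mod 4)` prime, `q ≠ 7`.** If `S = Σ_{j<56q} χ₈(j)·(j/q)·j²⁹` (sum over
`Finset.range (7·(4·(2q)))`) has `7 ∣ S`, `7² ∤ S`, then `‖B_{1,θ}‖₇ = 1` for every Teichmüller `ω` and every `θ` mod `7·8q` with values
`[j odd]·(−2q/j)·ω(j)⁴` — the Bernoulli certificate of KL19 Thm. 1.20 for `(X₀(49), 7, ℚ(√−2q))` in the `hcert` shape of file 4e's T1′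
(`n = 2q`). Witness of `θ ≠ 1`: `j = 56q − 1` (`χ₈(−1)·(−1/q) = −1`). [cite: KrizLi2019, Thm. 1.20 (p. 8) and §1.5 (1)]
[cite: Washington1997, §5.1 and Thm. 4.2] -/
theorem norm_generalizedBernoulli_theta1_twoPrime_of_sum_three {q : ℕ} [Fact q.Prime] (hq4 : q % 4 = 3) (hq7 : q ≠ 7)
    (S : ℤ)
    (hS : ∑ j ∈ Finset.range (7 * (4 * (2 * q))),
      ((if j % 2 = 0 then (0 : ℤ) else if j % 8 = 1 ∨ j % 8 = 7 then 1 else -1) * J((j : ℤ) | q)) * (j : ℤ) ^ (28 + 1) = S)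
    (h1 : (7 : ℤ) ∣ S) (h2 : ¬ (7 : ℤ) ^ 2 ∣ S)
    (ω : DirichletCharacter ℚ_[7] 7) (hω : IsTeichmullerCharacter ω) (θ : DirichletCharacter ℚ_[7] (7 * (4 * (2 * q))))
    (hθ : ∀ j : ZMod (7 * (4 * (2 * q))), θ j =
      ((if Even j.val then (0 : ℤ) else J(-((2 * q : ℕ) : ℤ) | j.val) : ℤ) : ℚ_[7]) * ω (j.val : ZMod 7) ^ 4) :
    ‖generalizedBernoulli 1 θ‖ = 1 := by
  have hq : q.Prime := Fact.out
  have hq0 : 0 < q := hq.pos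
  have hqodd : Odd q := Nat.odd_iff.mpr (by omega)
  have hθ' : ∀ j : ZMod (7 * (4 * (2 * q))), θ j =
      (((if j.val % 2 = 0 then (0 : ℤ) else if j.val % 8 = 1 ∨ j.val % 8 = 7 then 1 else -1) * J((j.val : ℤ) | q) : ℤ) : ℚ_[7]) * ω (j.val : ZMod 7) ^ 4 :=
    fun j => by rw [hθ j, kroneckerVal_negTwoPrime_eq_three hq4]
  have hθ1 : θ ≠ 1 := by
    intro h1
    obtain ⟨w, hw⟩ : ∃ w : ℕ, w + 1 = 7 * (4 * (2 * q)) := ⟨7 * (4 * (2 * q)) - 1, by omega⟩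
    have hv := hθ' ((w : ℕ) : ZMod (7 * (4 * (2 * q))))
    have hval : ((w : ℕ) : ZMod (7 * (4 * (2 * q)))).val = w := by
      rw [ZMod.val_natCast]; exact Nat.mod_eq_of_lt (by omega)
    have hw7 : ((w : ℕ) : ZMod 7) = ((6 : ℕ) : ZMod 7) := by
      rw [ZMod.natCast_eq_natCast_iff']; omega
    have hu : IsUnit ((w : ℕ) : ZMod (7 * (4 * (2 * q)))) := by
      rw [ZMod.isUnit_iff_coprime, ← hw]
      exact Nat.coprime_self_add_right.mpr (Nat.coprime_one_right _)
    rw [h1, hval, MulChar.one_apply hu, hw7, apply_neg_one_pow_four, mul_one] at hv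
    have hJ : J((w : ℤ) | q) = -1 := by
      have hwq : (w : ℤ) % (q : ℤ) = (-1 : ℤ) % (q : ℤ) := by
        have : (w : ℤ) = -1 + (q : ℤ) * 56 := by omega
        rw [this, Int.add_mul_emod_self_left]
      rw [jacobiSym.mod_left, hwq, ← jacobiSym.mod_left, jacobiSym.at_neg_one hqodd, ZMod.χ₄_nat_three_mod_four hq4]
    have hL : ((if w % 2 = 0 then (0 : ℤ) else if w % 8 = 1 ∨ w % 8 = 7 then 1 else -1) * J((w : ℤ) | q)) = -1 := by
      rw [if_neg (by omega), if_pos (by omega), hJ]; norm_num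
    rw [hL] at hv
    norm_num at hv
  refine norm_generalizedBernoulli_one_eq_one_of_cert_range θ hθ1 (padicValNat_seven_mul_four_mul_two_mul_prime hq7)
    (fun j => (if j % 2 = 0 then (0 : ℤ) else if j % 8 = 1 ∨ j % 8 = 7 then 1 else -1) * J((j : ℤ) | q)) 28 (fun j => ?_) S hS h1 h2
  have := norm_sub_le_of_values ω hω θ (fun j => (if j % 2 = 0 then (0 : ℤ) else if j % 8 = 1 ∨ j % 8 = 7 then 1 else -1) * J((j : ℤ) | q)) 4 (by norm_num) hθ' j
  simpa using this

/-! ## §2 T1′ / «D₂(q)» straight from the sum (`n = 2q` in file 4e) -/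

/-- `(−2q/7) = +1` for `(q/7) = −1` (`(−2/7) = −1`): `ℚ(√−2q)` is a Heegner field of `X₀(49)` — the `ℕ`-cast form of seat c301
gen 4's `jacobiSym_neg_two_mul_seven` (`…TwinBirchLemmaEight`, not imported here). [folklore] -/
theorem jacobiSym_neg_natCast_two_mul_seven {q : ℕ} (hq7 : jacobiSym q 7 = -1) : J(-((2 * q : ℕ) : ℤ) | 7) = 1 := by
  rw [show (-((2 * q : ℕ) : ℤ)) = (-2) * (q : ℤ) by push_cast; ring, jacobiSym.mul_left, hq7]
  norm_num

/-- **T1′ for `K = ℚ(√−2q)` from the sum** (`q` an odd prime, `(q/7) = −1`, either residue class mod `4`): every level-`49` Heegner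
point of `X₀(49)` over `K` (`d_K = −8q`) has infinite order, granted KL19 Thm. 1.20. [cite: KrizLi2019, Thm. 1.20 (pp. 7–8) and Rem. 1.21] -/
theorem not_isOfFinAddOrder_heegnerPoint_cm7_twoPrime_of_sum (h120 : thm120_padicLogHeegner_unit_of_bernoulli)
    {q : ℕ} [Fact q.Prime] (hq4 : q % 4 = 1 ∨ q % 4 = 3) (hq7 : jacobiSym q 7 = -1) (S : ℤ)
    (hS : (q % 4 = 1 → ∑ j ∈ Finset.range (7 * (4 * (2 * q))),
        ((if j % 2 = 0 then (0 : ℤ) else if j % 8 = 1 ∨ j % 8 = 3 then 1 else -1) * J((j : ℤ) | q)) * (j : ℤ) ^ (28 + 1) = S) ∧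
      (q % 4 = 3 → ∑ j ∈ Finset.range (7 * (4 * (2 * q))),
        ((if j % 2 = 0 then (0 : ℤ) else if j % 8 = 1 ∨ j % 8 = 7 then 1 else -1) * J((j : ℤ) | q)) * (j : ℤ) ^ (28 + 1) = S))
    (h1 : (7 : ℤ) ∣ S) (h2 : ¬ (7 : ℤ) ^ 2 ∣ S)
    (K : Type) [Field K] [NumberField K] (hK : IsImaginaryQuadratic K) (hdK : NumberField.discr K = -(8 * (q : ℤ)))
    {P : (cm7.baseChange K).toAffine.Point} (hP : IsHeegnerPoint 49 cm7 K P) : ¬ IsOfFinAddOrder P := by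
  have hq7' : q ≠ 7 := by
    rintro rfl
    exact absurd hq7 (by norm_num)
  have hdK' : NumberField.discr K = -(4 * ((2 * q : ℕ) : ℤ)) := by rw [hdK]; push_cast; ring
  rcases hq4 with h4 | h4
  · exact not_isOfFinAddOrder_heegnerPoint_cm7_of_thm120_evenDiscr h120 (n := 2 * q) (jacobiSym_neg_natCast_two_mul_seven hq7)
      (fun ω hω θ hθ => norm_generalizedBernoulli_theta1_twoPrime_of_sum_one h4 hq7' S (hS.1 h4) h1 h2 ω hω θ hθ) K hK hdK' hP
  · exact not_isOfFinAddOrder_heegnerPoint_cm7_of_thm120_evenDiscr h120 (n := 2 * q) (jacobiSym_neg_natCast_two_mul_seven hq7)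
      (fun ω hω θ hθ => norm_generalizedBernoulli_theta1_twoPrime_of_sum_three h4 hq7' S (hS.2 h4) h1 h2 ω hω θ hθ) K hK hdK' hP

/-- **«D₂(q)» from the sum**: `ord_{s=1} L(W, s) = 1` for every elliptic `W/ℚ` isomorphic to `49a1^{(−2q)}`, `q` an odd prime with
`(q/7) = −1` whose `n = 2q` certificate sum `S` has `7 ∥ S` — granted KL19 Thm. 1.20, Modularity, CLTZ Thm. 1.2 (`R = 1`), Gross–Zagier,
Heegner rationality (file 4e's T2′ at `n = 2q`: `2q ≡ 2 (mod 4)` squarefree). [cite: KrizLi2019, Thm. 1.20 (pp. 7–8)]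
[cite: GrossZagier1986, Thm. I.(6.3) and I.§7] -/
theorem analyticRank_eq_one_twoPrimeTwist_of_sum (h120 : thm120_padicLogHeegner_unit_of_bernoulli)
    (hnf : ModularForms.exists_isNewformOf) (h12 : CoatesLiTianZhai2015.thm12_fullBSD_twist)
    (hGZ : ∀ (N : ℕ) [NeZero N] (W : WeierstrassCurve ℚ) (K : Type) [Field K] [NumberField K],
      gross_zagier N W K)
    (hHP : ∀ (W : WeierstrassCurve ℚ) (K : Type) [Field K] [NumberField K], exists_isHeegnerPoint W K)
    {q : ℕ} [Fact q.Prime] (hq4 : q % 4 = 1 ∨ q % 4 = 3) (hq7 : jacobiSym q 7 = -1) (S : ℤ)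
    (hS : (q % 4 = 1 → ∑ j ∈ Finset.range (7 * (4 * (2 * q))),
        ((if j % 2 = 0 then (0 : ℤ) else if j % 8 = 1 ∨ j % 8 = 3 then 1 else -1) * J((j : ℤ) | q)) * (j : ℤ) ^ (28 + 1) = S) ∧
      (q % 4 = 3 → ∑ j ∈ Finset.range (7 * (4 * (2 * q))),
        ((if j % 2 = 0 then (0 : ℤ) else if j % 8 = 1 ∨ j % 8 = 7 then 1 else -1) * J((j : ℤ) | q)) * (j : ℤ) ^ (28 + 1) = S))
    (h1 : (7 : ℤ) ∣ S) (h2 : ¬ (7 : ℤ) ^ 2 ∣ S)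
    (W : WeierstrassCurve ℚ) [W.IsElliptic] (C : VariableChange ℚ)
    (hC : C • W = cm7.quadraticTwist ((-((2 * q : ℕ) : ℤ) : ℤ) : ℚ)) : W.analyticRank = 1 := by
  have hq : q.Prime := Fact.out
  have hq7' : q ≠ 7 := by
    rintro rfl
    exact absurd hq7 (by norm_num)
  have hq2 : q ≠ 2 := by omega
  have hn4 : (2 * q) % 4 = 1 ∨ (2 * q) % 4 = 2 := Or.inr (by omega)
  have hsq : Squarefree (2 * q) :=
    Nat.squarefree_mul_iff.mpr ⟨(Nat.coprime_primes Nat.prime_two hq).mpr (Ne.symm hq2), Nat.prime_two.squarefree, hq.squarefree⟩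
  rcases hq4 with h4 | h4
  · exact analyticRank_eq_one_negTwist_of_thm120_evenDiscr h120 hnf h12 hGZ hHP (n := 2 * q) hn4 hsq (jacobiSym_neg_natCast_two_mul_seven hq7)
      (fun ω hω θ hθ => norm_generalizedBernoulli_theta1_twoPrime_of_sum_one h4 hq7' S (hS.1 h4) h1 h2 ω hω θ hθ) W C hC
  · exact analyticRank_eq_one_negTwist_of_thm120_evenDiscr h120 hnf h12 hGZ hHP (n := 2 * q) hn4 hsq (jacobiSym_neg_natCast_two_mul_seven hq7)
      (fun ω hω θ hθ => norm_generalizedBernoulli_theta1_twoPrime_of_sum_three h4 hq7' S (hS.2 h4) h1 h2 ω hω θ hθ) W C hC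

/-! ## §3 Members: `q = 13, 17, 41` (`χ₈′` form) and `q = 19, 31, 47` (`χ₈` form) -/

set_option maxRecDepth 400000 in
/-- The `n = 26` certificate sum (`728` terms; `S ≡ 14 (mod 49)`), `decide +kernel`. [folklore] -/
theorem theta1_twoPrime_q13_sum :
    ∑ j ∈ Finset.range (7 * (4 * (2 * 13))),
      ((if j % 2 = 0 then (0 : ℤ) else if j % 8 = 1 ∨ j % 8 = 3 then 1 else -1) * J((j : ℤ) | 13)) * (j : ℤ) ^ (28 + 1) = (-496720868365768306880185882459143715022094228610544925143279705826283823295084043728) := by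
  simp_rw [jacobiSym_prime_eq_ite_nat 13 (by norm_num) (by norm_num)]
  decide +kernel

/-- **«D₂(13)» and T1′ over `ℚ(√−26)`**: every level-`49` Heegner point of `X₀(49)` over `K` with `d_K = −104` has infinite order
(granted KL19 Thm. 1.20), and `ord_{s=1} L(W, s) = 1` for every elliptic `W/ℚ` isomorphic to `49a1^{(−26)}` (granted moreover Modularity,
CLTZ Thm. 1.2, Gross–Zagier, Heegner rationality). [cite: KrizLi2019, Thm. 1.20 (pp. 7–8)] [cite: GrossZagier1986, Thm. I.(6.3) and I.§7] -/
theorem analyticRank_eq_one_twist_cm7_neg26 (h120 : thm120_padicLogHeegner_unit_of_bernoulli) :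
    (∀ (K : Type) [Field K] [NumberField K], IsImaginaryQuadratic K → NumberField.discr K = -104 →
      ∀ (P : (cm7.baseChange K).toAffine.Point), IsHeegnerPoint 49 cm7 K P → ¬ IsOfFinAddOrder P) ∧
    (ModularForms.exists_isNewformOf → CoatesLiTianZhai2015.thm12_fullBSD_twist →
      (∀ (N : ℕ) [NeZero N] (W : WeierstrassCurve ℚ) (K : Type) [Field K] [NumberField K], gross_zagier N W K) →
      (∀ (W : WeierstrassCurve ℚ) (K : Type) [Field K] [NumberField K], exists_isHeegnerPoint W K) →
      ∀ (W : WeierstrassCurve ℚ) [W.IsElliptic] (C : VariableChange ℚ), C • W = cm7.quadraticTwist (-26) →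
        W.analyticRank = 1) := by
  haveI : Fact (Nat.Prime 13) := ⟨by norm_num⟩
  refine ⟨fun K _ _ hK hdK P hP => ?_, fun hnf h12 hGZ hHP W _ C hC => ?_⟩
  · exact not_isOfFinAddOrder_heegnerPoint_cm7_twoPrime_of_sum h120 (q := 13) (by norm_num) (by norm_num) _
      ⟨fun _ => theta1_twoPrime_q13_sum, fun h => absurd h (by norm_num)⟩ (by norm_num) (by norm_num) K hK (by rw [hdK]; norm_num) hP
  · exact analyticRank_eq_one_twoPrimeTwist_of_sum h120 hnf h12 hGZ hHP (q := 13) (by norm_num) (by norm_num) _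
      ⟨fun _ => theta1_twoPrime_q13_sum, fun h => absurd h (by norm_num)⟩ (by norm_num) (by norm_num) W C (by rw [hC]; norm_num)

set_option maxRecDepth 400000 in
/-- The `n = 34` certificate sum (`952` terms; `S ≡ 7 (mod 49)`), `decide +kernel`. [folklore] -/
theorem theta1_twoPrime_q17_sum :
    ∑ j ∈ Finset.range (7 * (4 * (2 * 17))),
      ((if j % 2 = 0 then (0 : ℤ) else if j % 8 = 1 ∨ j % 8 = 3 then 1 else -1) * J((j : ℤ) | 17)) * (j : ℤ) ^ (28 + 1) = (-698280763230526533995725823493917728880340037559696270718454816811574249048366212615008) := by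
  simp_rw [jacobiSym_prime_eq_ite_nat 17 (by norm_num) (by norm_num)]
  decide +kernel

/-- **«D₂(17)» and T1′ over `ℚ(√−34)`**: every level-`49` Heegner point of `X₀(49)` over `K` with `d_K = −136` has infinite order
(granted KL19 Thm. 1.20), and `ord_{s=1} L(W, s) = 1` for every elliptic `W/ℚ` isomorphic to `49a1^{(−34)}` (granted moreover Modularity,
CLTZ Thm. 1.2, Gross–Zagier, Heegner rationality). [cite: KrizLi2019, Thm. 1.20 (pp. 7–8)] [cite: GrossZagier1986, Thm. I.(6.3) and I.§7] -/
theorem analyticRank_eq_one_twist_cm7_neg34 (h120 : thm120_padicLogHeegner_unit_of_bernoulli) :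
    (∀ (K : Type) [Field K] [NumberField K], IsImaginaryQuadratic K → NumberField.discr K = -136 →
      ∀ (P : (cm7.baseChange K).toAffine.Point), IsHeegnerPoint 49 cm7 K P → ¬ IsOfFinAddOrder P) ∧
    (ModularForms.exists_isNewformOf → CoatesLiTianZhai2015.thm12_fullBSD_twist →
      (∀ (N : ℕ) [NeZero N] (W : WeierstrassCurve ℚ) (K : Type) [Field K] [NumberField K], gross_zagier N W K) →
      (∀ (W : WeierstrassCurve ℚ) (K : Type) [Field K] [NumberField K], exists_isHeegnerPoint W K) →
      ∀ (W : WeierstrassCurve ℚ) [W.IsElliptic] (C : VariableChange ℚ), C • W = cm7.quadraticTwist (-34) →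
        W.analyticRank = 1) := by
  haveI : Fact (Nat.Prime 17) := ⟨by norm_num⟩
  refine ⟨fun K _ _ hK hdK P hP => ?_, fun hnf h12 hGZ hHP W _ C hC => ?_⟩
  · exact not_isOfFinAddOrder_heegnerPoint_cm7_twoPrime_of_sum h120 (q := 17) (by norm_num) (by norm_num) _
      ⟨fun _ => theta1_twoPrime_q17_sum, fun h => absurd h (by norm_num)⟩ (by norm_num) (by norm_num) K hK (by rw [hdK]; norm_num) hP
  · exact analyticRank_eq_one_twoPrimeTwist_of_sum h120 hnf h12 hGZ hHP (q := 17) (by norm_num) (by norm_num) _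
      ⟨fun _ => theta1_twoPrime_q17_sum, fun h => absurd h (by norm_num)⟩ (by norm_num) (by norm_num) W C (by rw [hC]; norm_num)

set_option maxRecDepth 400000 in
/-- The `n = 82` certificate sum (`2296` terms; `S ≡ 14 (mod 49)`), `decide +kernel`. [folklore] -/
theorem theta1_twoPrime_q41_sum :
    ∑ j ∈ Finset.range (7 * (4 * (2 * 41))),
      ((if j % 2 = 0 then (0 : ℤ) else if j % 8 = 1 ∨ j % 8 = 3 then 1 else -1) * J((j : ℤ) | 41)) * (j : ℤ) ^ (28 + 1) = (-68776075057068188929086110972159705572354207083899810361098306778475158747120949415622329226274144) := by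
  simp_rw [jacobiSym_prime_eq_ite_nat 41 (by norm_num) (by norm_num)]
  decide +kernel

/-- **«D₂(41)» and T1′ over `ℚ(√−82)`**: every level-`49` Heegner point of `X₀(49)` over `K` with `d_K = −328` has infinite order
(granted KL19 Thm. 1.20), and `ord_{s=1} L(W, s) = 1` for every elliptic `W/ℚ` isomorphic to `49a1^{(−82)}` (granted moreover Modularity,
CLTZ Thm. 1.2, Gross–Zagier, Heegner rationality). [cite: KrizLi2019, Thm. 1.20 (pp. 7–8)] [cite: GrossZagier1986, Thm. I.(6.3) and I.§7] -/
theorem analyticRank_eq_one_twist_cm7_neg82 (h120 : thm120_padicLogHeegner_unit_of_bernoulli) :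
    (∀ (K : Type) [Field K] [NumberField K], IsImaginaryQuadratic K → NumberField.discr K = -328 →
      ∀ (P : (cm7.baseChange K).toAffine.Point), IsHeegnerPoint 49 cm7 K P → ¬ IsOfFinAddOrder P) ∧
    (ModularForms.exists_isNewformOf → CoatesLiTianZhai2015.thm12_fullBSD_twist →
      (∀ (N : ℕ) [NeZero N] (W : WeierstrassCurve ℚ) (K : Type) [Field K] [NumberField K], gross_zagier N W K) →
      (∀ (W : WeierstrassCurve ℚ) (K : Type) [Field K] [NumberField K], exists_isHeegnerPoint W K) →
      ∀ (W : WeierstrassCurve ℚ) [W.IsElliptic] (C : VariableChange ℚ), C • W = cm7.quadraticTwist (-82) →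
        W.analyticRank = 1) := by
  haveI : Fact (Nat.Prime 41) := ⟨by norm_num⟩
  refine ⟨fun K _ _ hK hdK P hP => ?_, fun hnf h12 hGZ hHP W _ C hC => ?_⟩
  · exact not_isOfFinAddOrder_heegnerPoint_cm7_twoPrime_of_sum h120 (q := 41) (by norm_num) (by norm_num) _
      ⟨fun _ => theta1_twoPrime_q41_sum, fun h => absurd h (by norm_num)⟩ (by norm_num) (by norm_num) K hK (by rw [hdK]; norm_num) hP
  · exact analyticRank_eq_one_twoPrimeTwist_of_sum h120 hnf h12 hGZ hHP (q := 41) (by norm_num) (by norm_num) _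
      ⟨fun _ => theta1_twoPrime_q41_sum, fun h => absurd h (by norm_num)⟩ (by norm_num) (by norm_num) W C (by rw [hC]; norm_num)

set_option maxRecDepth 400000 in
/-- The `n = 38` certificate sum (`1064` terms; `S ≡ 42 (mod 49)`), `decide +kernel`. [folklore] -/
theorem theta1_twoPrime_q19_sum :
    ∑ j ∈ Finset.range (7 * (4 * (2 * 19))),
      ((if j % 2 = 0 then (0 : ℤ) else if j % 8 = 1 ∨ j % 8 = 7 then 1 else -1) * J((j : ℤ) | 19)) * (j : ℤ) ^ (28 + 1) = (-28720945740703273354656014761655434191317036918833724276912689822249636569893649970968624) := by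
  simp_rw [jacobiSym_prime_eq_ite_nat 19 (by norm_num) (by norm_num)]
  decide +kernel

/-- **«D₂(19)» and T1′ over `ℚ(√−38)`**: every level-`49` Heegner point of `X₀(49)` over `K` with `d_K = −152` has infinite order
(granted KL19 Thm. 1.20), and `ord_{s=1} L(W, s) = 1` for every elliptic `W/ℚ` isomorphic to `49a1^{(−38)}` (granted moreover Modularity,
CLTZ Thm. 1.2, Gross–Zagier, Heegner rationality). [cite: KrizLi2019, Thm. 1.20 (pp. 7–8)] [cite: GrossZagier1986, Thm. I.(6.3) and I.§7] -/
theorem analyticRank_eq_one_twist_cm7_neg38 (h120 : thm120_padicLogHeegner_unit_of_bernoulli) :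
    (∀ (K : Type) [Field K] [NumberField K], IsImaginaryQuadratic K → NumberField.discr K = -152 →
      ∀ (P : (cm7.baseChange K).toAffine.Point), IsHeegnerPoint 49 cm7 K P → ¬ IsOfFinAddOrder P) ∧
    (ModularForms.exists_isNewformOf → CoatesLiTianZhai2015.thm12_fullBSD_twist →
      (∀ (N : ℕ) [NeZero N] (W : WeierstrassCurve ℚ) (K : Type) [Field K] [NumberField K], gross_zagier N W K) →
      (∀ (W : WeierstrassCurve ℚ) (K : Type) [Field K] [NumberField K], exists_isHeegnerPoint W K) →
      ∀ (W : WeierstrassCurve ℚ) [W.IsElliptic] (C : VariableChange ℚ), C • W = cm7.quadraticTwist (-38) →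
        W.analyticRank = 1) := by
  haveI : Fact (Nat.Prime 19) := ⟨by norm_num⟩
  refine ⟨fun K _ _ hK hdK P hP => ?_, fun hnf h12 hGZ hHP W _ C hC => ?_⟩
  · exact not_isOfFinAddOrder_heegnerPoint_cm7_twoPrime_of_sum h120 (q := 19) (by norm_num) (by norm_num) _
      ⟨fun h => absurd h (by norm_num), fun _ => theta1_twoPrime_q19_sum⟩ (by norm_num) (by norm_num) K hK (by rw [hdK]; norm_num) hP
  · exact analyticRank_eq_one_twoPrimeTwist_of_sum h120 hnf h12 hGZ hHP (q := 19) (by norm_num) (by norm_num) _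
      ⟨fun h => absurd h (by norm_num), fun _ => theta1_twoPrime_q19_sum⟩ (by norm_num) (by norm_num) W C (by rw [hC]; norm_num)

set_option maxRecDepth 400000 in
/-- The `n = 62` certificate sum (`1736` terms; `S ≡ 28 (mod 49)`), `decide +kernel`. [folklore] -/
theorem theta1_twoPrime_q31_sum :
    ∑ j ∈ Finset.range (7 * (4 * (2 * 31))),
      ((if j % 2 = 0 then (0 : ℤ) else if j % 8 = 1 ∨ j % 8 = 7 then 1 else -1) * J((j : ℤ) | 31)) * (j : ℤ) ^ (28 + 1) = (-56677105130547737351218186363332126342352488991896234111538330131270440666133717634104882349888) := by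
  simp_rw [jacobiSym_prime_eq_ite_nat 31 (by norm_num) (by norm_num)]
  decide +kernel

/-- **«D₂(31)» and T1′ over `ℚ(√−62)`**: every level-`49` Heegner point of `X₀(49)` over `K` with `d_K = −248` has infinite order
(granted KL19 Thm. 1.20), and `ord_{s=1} L(W, s) = 1` for every elliptic `W/ℚ` isomorphic to `49a1^{(−62)}` (granted moreover Modularity,
CLTZ Thm. 1.2, Gross–Zagier, Heegner rationality). [cite: KrizLi2019, Thm. 1.20 (pp. 7–8)] [cite: GrossZagier1986, Thm. I.(6.3) and I.§7] -/
theorem analyticRank_eq_one_twist_cm7_neg62 (h120 : thm120_padicLogHeegner_unit_of_bernoulli) :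
    (∀ (K : Type) [Field K] [NumberField K], IsImaginaryQuadratic K → NumberField.discr K = -248 →
      ∀ (P : (cm7.baseChange K).toAffine.Point), IsHeegnerPoint 49 cm7 K P → ¬ IsOfFinAddOrder P) ∧
    (ModularForms.exists_isNewformOf → CoatesLiTianZhai2015.thm12_fullBSD_twist →
      (∀ (N : ℕ) [NeZero N] (W : WeierstrassCurve ℚ) (K : Type) [Field K] [NumberField K], gross_zagier N W K) →
      (∀ (W : WeierstrassCurve ℚ) (K : Type) [Field K] [NumberField K], exists_isHeegnerPoint W K) →
      ∀ (W : WeierstrassCurve ℚ) [W.IsElliptic] (C : VariableChange ℚ), C • W = cm7.quadraticTwist (-62) →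
        W.analyticRank = 1) := by
  haveI : Fact (Nat.Prime 31) := ⟨by norm_num⟩
  refine ⟨fun K _ _ hK hdK P hP => ?_, fun hnf h12 hGZ hHP W _ C hC => ?_⟩
  · exact not_isOfFinAddOrder_heegnerPoint_cm7_twoPrime_of_sum h120 (q := 31) (by norm_num) (by norm_num) _
      ⟨fun h => absurd h (by norm_num), fun _ => theta1_twoPrime_q31_sum⟩ (by norm_num) (by norm_num) K hK (by rw [hdK]; norm_num) hP
  · exact analyticRank_eq_one_twoPrimeTwist_of_sum h120 hnf h12 hGZ hHP (q := 31) (by norm_num) (by norm_num) _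
      ⟨fun h => absurd h (by norm_num), fun _ => theta1_twoPrime_q31_sum⟩ (by norm_num) (by norm_num) W C (by rw [hC]; norm_num)

set_option maxRecDepth 400000 in
/-- The `n = 94` certificate sum (`2632` terms; `S ≡ 14 (mod 49)`), `decide +kernel`. [folklore] -/
theorem theta1_twoPrime_q47_sum :
    ∑ j ∈ Finset.range (7 * (4 * (2 * 47))),
      ((if j % 2 = 0 then (0 : ℤ) else if j % 8 = 1 ∨ j % 8 = 7 then 1 else -1) * J((j : ℤ) | 47)) * (j : ℤ) ^ (28 + 1) = (-9530996828525137713149163630062827703833935790392004555182247892923430398493983033060305565218003776) := by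
  simp_rw [jacobiSym_prime_eq_ite_nat 47 (by norm_num) (by norm_num)]
  decide +kernel

/-- **«D₂(47)» and T1′ over `ℚ(√−94)`**: every level-`49` Heegner point of `X₀(49)` over `K` with `d_K = −376` has infinite order
(granted KL19 Thm. 1.20), and `ord_{s=1} L(W, s) = 1` for every elliptic `W/ℚ` isomorphic to `49a1^{(−94)}` (granted moreover Modularity,
CLTZ Thm. 1.2, Gross–Zagier, Heegner rationality). [cite: KrizLi2019, Thm. 1.20 (pp. 7–8)] [cite: GrossZagier1986, Thm. I.(6.3) and I.§7] -/
theorem analyticRank_eq_one_twist_cm7_neg94 (h120 : thm120_padicLogHeegner_unit_of_bernoulli) :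
    (∀ (K : Type) [Field K] [NumberField K], IsImaginaryQuadratic K → NumberField.discr K = -376 →
      ∀ (P : (cm7.baseChange K).toAffine.Point), IsHeegnerPoint 49 cm7 K P → ¬ IsOfFinAddOrder P) ∧
    (ModularForms.exists_isNewformOf → CoatesLiTianZhai2015.thm12_fullBSD_twist →
      (∀ (N : ℕ) [NeZero N] (W : WeierstrassCurve ℚ) (K : Type) [Field K] [NumberField K], gross_zagier N W K) →
      (∀ (W : WeierstrassCurve ℚ) (K : Type) [Field K] [NumberField K], exists_isHeegnerPoint W K) →
      ∀ (W : WeierstrassCurve ℚ) [W.IsElliptic] (C : VariableChange ℚ), C • W = cm7.quadraticTwist (-94) →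
        W.analyticRank = 1) := by
  haveI : Fact (Nat.Prime 47) := ⟨by norm_num⟩
  refine ⟨fun K _ _ hK hdK P hP => ?_, fun hnf h12 hGZ hHP W _ C hC => ?_⟩
  · exact not_isOfFinAddOrder_heegnerPoint_cm7_twoPrime_of_sum h120 (q := 47) (by norm_num) (by norm_num) _
      ⟨fun h => absurd h (by norm_num), fun _ => theta1_twoPrime_q47_sum⟩ (by norm_num) (by norm_num) K hK (by rw [hdK]; norm_num) hP
  · exact analyticRank_eq_one_twoPrimeTwist_of_sum h120 hnf h12 hGZ hHP (q := 47) (by norm_num) (by norm_num) _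
      ⟨fun h => absurd h (by norm_num), fun _ => theta1_twoPrime_q47_sum⟩ (by norm_num) (by norm_num) W C (by rw [hC]; norm_num)

end Summit.BirchSwinnertonDyer.BirchSwinnertonDyer.Theorems.GoldfeldGoodTwists

end
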